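import Literature.NumberTheory.QuadraticForms.UnimodularIsotropyFour
import HarnessLib

/-!
# Indefinite unimodular integral forms represent zero (Serre V §2.2 Thm. 3, matrix form)

Topic `NumberTheory/QuadraticForms`; namespace `Literature.NumberTheory.QuadraticForms`. Everything
here is proved; conclusion of `UnimodularIsotropyLocal.lean` / `UnimodularIsotropyFour.lean`.

**Theorem** (Serre, *A Course in Arithmetic*, Ch. V §2.2 Thm. 3, proof in §3.1): a symmetric
integer matrix `G` of size `n ≥ 3` with `det G = ±1` whose form `ᵗxGx` takes both signs has a
non-trivial integer zero (`exists_int_zero_of_isUnit_det`). Choose an integral orthogonal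
diagonalisation `⟨d₁, …, dₙ⟩` (`exists_orthogonalFamily_not_dvd` at `p = 3`); a rational zero of
`⟨d⟩` gives an integer zero of `G` (`exists_int_zero_of_diag_zero_rat`), and `⟨d⟩` represents `0`
over `ℚ`:

* `n = 3`: `exists_diag_zero_rat_three` (Serre V §3.1 (ii));
* `n = 4`: `exists_diag_zero_rat_four` (§3.1 (iii));
* `n ≥ 5`: **Meyer's theorem** (§3.1 (iv); `exists_quinary_zero_rat_of_indefinite`) applied to
  five of the `dᵢ` containing both signs (after permuting the frame).

Rank `2` (§3.1 (i)) is `LatticeFormsRepresentsZeroRankTwo.lean`; the statement for abstract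
lattices (`LinearMap.BilinForm.exists_isotropic_of_isIndefinite`) is discharged in
`Topology/FourManifolds/LatticeFormsRepresentsZeroProofs.lean`.

## References

* J.-P. Serre, *A Course in Arithmetic*, GTM 7, Springer 1973, Ch. V §2.2 Thm. 3, §3.1 (PDF
  pp. 53, 56–57); Ch. IV §3.2 Cor. 2 (Meyer). [Serre1973]
-/

noncomputable section

open IsDedekindDomain NumberField Rat.HeightOneSpectrum Finset Matrix

namespace Literature.NumberTheory.QuadraticForms

variable {n : ℕ} {G : Matrix (Fin n) (Fin n) ℤ}

/-- **Serre V §3.1 (iv), `n ≥ 5` (Meyer)**: an integral orthogonal diagonalisation of an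
indefinite integral form of rank `5 + m` represents `0` over `ℚ` — permute the frame so that
`d₀ < 0 < d₁` and apply Meyer's theorem to `⟨d₀, …, d₄⟩`. [cite: Serre1973, Ch. V §3.1] -/
theorem exists_int_zero_of_frame_five_add {m : ℕ} {G : Matrix (Fin (5 + m)) (Fin (5 + m)) ℤ}
    {f : Fin (5 + m) → (Fin (5 + m) → ℤ)}
    (hfo : ∀ i j, i ≠ j → Matrix.toBilin' G (f i) (f j) = 0)
    (hfn : ∀ i, Matrix.toBilin' G (f i) (f i) ≠ 0)
    {ineg ipos : Fin (5 + m)} (hineg : Matrix.toBilin' G (f ineg) (f ineg) < 0)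
    (hipos : 0 < Matrix.toBilin' G (f ipos) (f ipos)) :
    ∃ x : Fin (5 + m) → ℤ, x ≠ 0 ∧ Matrix.toBilin' G x x = 0 := by
  classical
  -- permute the frame: `σ c₀ = ineg`, `σ c₁ = ipos`
  set c₀ : Fin (5 + m) := Fin.castAdd m (0 : Fin 5) with hc₀
  set c₁ : Fin (5 + m) := Fin.castAdd m (1 : Fin 5) with hc₁
  have hc01 : c₀ ≠ c₁ := fun h ↦ by
    have := Fin.castAdd_injective _ _ h
    exact absurd this (by decide)
  have hne : ineg ≠ ipos := fun h ↦ by rw [h] at hineg; exact lt_asymm hineg hipos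
  set τ₁ : Equiv.Perm (Fin (5 + m)) := Equiv.swap c₀ ineg with hτ₁
  set j : Fin (5 + m) := τ₁ ipos with hj
  have hj0 : j ≠ c₀ := fun h ↦ hne (by
    have h1 : τ₁ j = ipos := by rw [hj, hτ₁, Equiv.swap_apply_self]
    rw [h, hτ₁, Equiv.swap_apply_left] at h1
    exact h1)
  set τ₂ : Equiv.Perm (Fin (5 + m)) := Equiv.swap c₁ j with hτ₂
  set σ : Equiv.Perm (Fin (5 + m)) := τ₂.trans τ₁ with hσ
  have hσ0 : σ c₀ = ineg := by
    rw [hσ, Equiv.trans_apply, hτ₂, Equiv.swap_apply_of_ne_of_ne hc01 hj0.symm, hτ₁,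
      Equiv.swap_apply_left]
  have hσ1 : σ c₁ = ipos := by
    rw [hσ, Equiv.trans_apply, hτ₂, Equiv.swap_apply_left, hj, hτ₁, Equiv.swap_apply_self]
  -- the permuted frame
  set g : Fin (5 + m) → (Fin (5 + m) → ℤ) := f ∘ σ with hg
  have hgo : ∀ i j, i ≠ j → Matrix.toBilin' G (g i) (g j) = 0 := fun i j hij ↦
    hfo _ _ (σ.injective.ne hij)
  have hgn : ∀ i, Matrix.toBilin' G (g i) (g i) ≠ 0 := fun i ↦ hfn _
  refine exists_int_zero_of_diag_zero_rat hgo hgn ?_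
  -- Meyer on the first five coefficients
  set a : Fin 5 → ℚ := fun k ↦ (Matrix.toBilin' G (g (Fin.castAdd m k)) (g (Fin.castAdd m k)) : ℚ)
    with ha
  have ha0 : ∀ k, a k ≠ 0 := fun k ↦ by
    change (Matrix.toBilin' G (g (Fin.castAdd m k)) (g (Fin.castAdd m k)) : ℚ) ≠ 0
    exact_mod_cast hgn _
  have ha0' : a 0 < 0 := by
    change (Matrix.toBilin' G (f (σ c₀)) (f (σ c₀)) : ℚ) < 0
    rw [hσ0]; exact_mod_cast hineg
  have ha1' : 0 < a 1 := by
    change (0 : ℚ) < Matrix.toBilin' G (f (σ c₁)) (f (σ c₁))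
    rw [hσ1]; exact_mod_cast hipos
  obtain ⟨x, hx0, hx⟩ := exists_quinary_zero_rat_of_indefinite (ha0 0) (ha0 1) (ha0 2) (ha0 3)
    (ha0 4) (fun h ↦ lt_asymm ha0' h.1) (fun h ↦ lt_asymm ha1' h.2.1)
  refine ⟨Fin.append x 0, fun h0 ↦ hx0 ?_, ?_⟩
  · funext k
    have := congrFun h0 (Fin.castAdd m k)
    simpa [Fin.append_left] using this
  · rw [Fin.sum_univ_add]
    simp only [Fin.append_left, Fin.append_right, Pi.zero_apply, ne_eq, OfNat.ofNat_ne_zero,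
      not_false_eq_true, zero_pow, mul_zero, Finset.sum_const_zero, add_zero, Fin.sum_univ_five]
    exact hx

/-- **Serre, Ch. V §2.2 Theorem 3 (matrix form): an indefinite unimodular integral quadratic form
of rank `≥ 3` represents zero.** For a symmetric integer matrix `G` of size `n ≥ 3` with
`det G = ±1` such that `ᵗxGx` takes a negative and a positive value on `ℤⁿ`, there is `x ∈ ℤⁿ`,
`x ≠ 0`, with `ᵗxGx = 0`. Proof as in Serre V §3.1 (ii)–(iv) (Hasse–Minkowski for `n = 3, 4`,
Meyer for `n ≥ 5`) on an integral orthogonal diagonalisation. [cite: Serre1973, Ch. V §2.2 Thm. 3] -/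
theorem exists_int_zero_of_isUnit_det (hn : 3 ≤ n) (hG : G.IsSymm) (hdet : IsUnit G.det)
    (hneg : ∃ y : Fin n → ℤ, Matrix.toBilin' G y y < 0) (hpos : ∃ y : Fin n → ℤ, 0 < Matrix.toBilin' G y y) :
    ∃ x : Fin n → ℤ, x ≠ 0 ∧ Matrix.toBilin' G x x = 0 := by
  haveI := Fact.mk Nat.prime_three
  obtain ⟨f, hfo, hfu⟩ := exists_orthogonalFamily_not_dvd (p := 3) (by norm_num) hG
    (not_dvd_det_of_isUnit hdet Nat.prime_three)
  have hfn : ∀ i, Matrix.toBilin' G (f i) (f i) ≠ 0 := fun i h ↦ hfu i (h ▸ dvd_zero _)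
  obtain ⟨y, hy⟩ := hneg
  obtain ⟨y', hy'⟩ := hpos
  obtain ⟨ineg, hineg⟩ := exists_neg_of_apply_neg hfo hfn hy
  obtain ⟨ipos, hipos⟩ := exists_pos_of_apply_pos hfo hfn hy'
  rcases Nat.lt_or_ge n 5 with h5 | h5
  · obtain rfl | rfl : n = 3 ∨ n = 4 := by omega
    · exact exists_int_zero_of_diag_zero_rat hfo hfn
        (exists_diag_zero_rat_three hG hdet hfo hfn ⟨ineg, hineg⟩ ⟨ipos, hipos⟩)
    · exact exists_int_zero_of_diag_zero_rat hfo hfn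
        (exists_diag_zero_rat_four hG hdet hfo hfn ⟨ineg, hineg⟩ ⟨ipos, hipos⟩)
  · obtain ⟨m, rfl⟩ := Nat.exists_eq_add_of_le h5
    exact exists_int_zero_of_frame_five_add hfo hfn hineg hipos

end Literature.NumberTheory.QuadraticForms
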